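import Mathlib

/-!
# Non-vanishing of a restricted tensor product (Step 1(β))

Kernel annex of sub-claim B5 (single-level positivity + level), file 9. Step 1(β) of the proof of
Theorem B5.1 in the owner section `route/T4-B5-p8.md` shows that the adèlic oscillator
representation `ω(μ, ε, χ) = ⊗'_v ω(μ_v, ε_v, χ_v)` is non-zero: the restricted tensor product is
the direct limit, over finite sets `S` of places, of the finite tensor products `⊗_{v ∈ S} ω_v`
along the maps `x ↦ x ⊗ φ⁰_{v'}` (`φ⁰_{v'} ≠ 0` the distinguished unramified vector), each finite
tensor product of non-zero vector spaces is non-zero, and the transition maps are injective, so the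
limit is non-zero. This file kernel-checks the two abstract facts behind that sentence:

* `of_ne_zero_of_injective`, `nontrivial_directLimit_of_injective` — in a directed system of
  modules with INJECTIVE transition maps, a non-zero element of a component stays non-zero in the
  direct limit (Mathlib's `Module.DirectLimit.of.zero_exact`); hence the limit of non-zero
  components is non-zero.
* `tmul_right_injective`, `tmul_ne_zero` — over a field, `x ↦ x ⊗ m` is injective for `m ≠ 0`
  (a functional `φ` with `φ m = 1` gives the left inverse `(id ⊗ φ)` followed by `V ⊗ k ≃ V`), and
  the tensor product of two non-zero vectors is non-zero (so a finite tensor product of non-zero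
  vector spaces is non-zero, by induction on the number of factors).

The identification of Liu's `⊗_v` (p. 46 ll. 50–61, E5) with this direct-limit model, and the
non-vanishing of each local factor (Lemma D.1(1), E12), remain the prose's.
-/

namespace Summit.Ventures.HodgeRepro2.LevelPositivity

open TensorProduct

section DirectLimit

variable {R : Type*} [Semiring R] {ι : Type*} [Preorder ι] [IsDirectedOrder ι] [DecidableEq ι]
  {G : ι → Type*}
  [∀ i, AddCommMonoid (G i)] [∀ i, Module R (G i)] (f : ∀ i j, i ≤ j → G i →ₗ[R] G j)
  [DirectedSystem G (f · · ·)]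

/-- In a directed system with injective transition maps, a non-zero element of a component is
non-zero in the direct limit: if it vanished there, it would vanish in some later component
(`Module.DirectLimit.of.zero_exact`), contradicting injectivity. -/
theorem of_ne_zero_of_injective (hf : ∀ i j (hij : i ≤ j), Function.Injective (f i j hij))
    {i : ι} {x : G i} (hx : x ≠ 0) : Module.DirectLimit.of R ι G f i x ≠ 0 := by
  intro h
  obtain ⟨j, hij, hj⟩ := Module.DirectLimit.of.zero_exact h
  exact hx (hf i j hij (by rw [hj, map_zero]))

/-- The direct limit of non-zero modules along injective transition maps is non-zero. -/
theorem nontrivial_directLimit_of_injective [Nonempty ι]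
    (hf : ∀ i j (hij : i ≤ j), Function.Injective (f i j hij)) (hG : ∀ i, ∃ x : G i, x ≠ 0) :
    Nontrivial (Module.DirectLimit G f) := by
  obtain ⟨i⟩ := ‹Nonempty ι›
  obtain ⟨x, hx⟩ := hG i
  exact ⟨⟨_, 0, of_ne_zero_of_injective f hf hx⟩⟩

end DirectLimit

section Tensor

variable {k : Type*} [Field k] {V N : Type*} [AddCommGroup V] [Module k V] [AddCommGroup N]
  [Module k N]

/-- Over a field, `x ↦ x ⊗ m` is injective for `m ≠ 0`: a linear functional `φ` with `φ m = 1`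
(`Module.Projective.exists_dual_eq_one`) gives the left inverse
`V ⊗ N → V ⊗ k ≃ V`, `x ⊗ n ↦ φ n • x`. -/
theorem tmul_right_injective {m : N} (hm : m ≠ 0) :
    Function.Injective (fun x : V => x ⊗ₜ[k] m) := by
  obtain ⟨φ, hφ⟩ := Module.Projective.exists_dual_eq_one k hm
  have key : ∀ x : V, (TensorProduct.rid k V) ((LinearMap.lTensor V φ) (x ⊗ₜ[k] m)) = x := by
    intro x
    rw [LinearMap.lTensor_tmul, TensorProduct.rid_tmul, hφ, one_smul]
  intro x y hxy
  have := congrArg (fun t => (TensorProduct.rid k V) ((LinearMap.lTensor V φ) t)) hxy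
  simp only at this
  rwa [key, key] at this

/-- The tensor product of two non-zero vectors is non-zero. -/
theorem tmul_ne_zero {x : V} (hx : x ≠ 0) {m : N} (hm : m ≠ 0) : x ⊗ₜ[k] m ≠ 0 := by
  intro h
  apply hx
  exact tmul_right_injective hm (show x ⊗ₜ[k] m = (0 : V) ⊗ₜ[k] m by rw [h, TensorProduct.zero_tmul])

/-- A tensor product of two non-zero vector spaces is non-zero. -/
theorem nontrivial_tensorProduct [Nontrivial V] [Nontrivial N] : Nontrivial (V ⊗[k] N) := by
  obtain ⟨x, hx⟩ := exists_ne (0 : V)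
  obtain ⟨m, hm⟩ := exists_ne (0 : N)
  exact ⟨⟨x ⊗ₜ[k] m, 0, tmul_ne_zero hx hm⟩⟩

end Tensor

end Summit.Ventures.HodgeRepro2.LevelPositivity
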